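import Summits.FinalStateConjecture.FinalStateConjecture.Theorems.EIHFluxBalanceModulatedKerrHandoffBentLabChartAux1
import Summits.FinalStateConjecture.FinalStateConjecture.Theorems.EIHFluxBalanceModulatedKerrHandoffBentLabDeviationAux1
import Summits.FinalStateConjecture.FinalStateConjecture.Theorems.SwallowTheDatumKerrShieldedSettlesStubKerrExteriorDecompositionAdapters
import HarnessLib

set_option linter.dupNamespace false

/-!
# Stub `stub_bentLabSmooth` (T2a) of line `swallow-transfer`, crux `EIHFluxBalance.ModulatedKerrHandoff` (stmt-FinalStateConjecture-10167)

Support file for crux `stmt-FinalStateConjecture-10167`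
(`Summit.FinalStateConjecture.FinalStateConjecture.Theses.EIHFluxBalance.ModulatedKerrHandoff`), line
`swallow-transfer`: the registered stub `stub_bentLabSmooth` (statement VERBATIM from the registered skeleton
`Cruxes/ModulatedKerrHandoff/Lines/swallow_transfer.lean`).

**The bent lab chart.** `f(x) = x + Θ(x) e₀` with the shift `Θ(x) = χ₁(|x̲|/x⁰ − 1) · T(|x̲|)`
(`χ₁ = Real.smoothTransition`, `T = bentHeight M a`, `|x̲| = E4.spatialNorm x`, `e₀ = E4.basisVector 0`):
a Kerr–Schild time translation depending on lab time. This file proves, for sub-extremal `(M, a)` and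
every `τ₀ ≥ τa := 2048 M`:

* `f` is `C^∞` on the half-space `{x⁰ > τ₀}`: `Θ` is the product of the cutoff, smooth on `{x⁰ > 0}`
  (`BentLabDeviation.contDiffAt_cutoff`), and the radial height, smooth everywhere
  (`BentLabDeviation.contDiff_radialHeight`);
* `f` restricted to the pinned domain `{x⁰ > τ₀, r > rin}` is an open embedding: it is continuous,
  injective (it preserves the time fibres `{x̲ = const}` and on the fibre over `x̲`, `ρ = |x̲|`, it is the
  fibre map `s ↦ s + χ₁(ρ/s − 1) T(ρ)`, strictly increasing on `[2048 M, ∞)` by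
  `SwallowTransfer.strictMonoOn_fibreMap`; packaged by `ExteriorDecomposition.injOn_timeShift`), and open
  (inverse function theorem for time shifts, `ExteriorDecomposition.map_nhds_timeShift`: the derivative
  `id + dΘ ⊗ e₀` is invertible since `∂₀Θ` is the fibre derivative, of absolute value `≤ 1/2` by
  `SwallowTransfer.abs_fibreDeriv_le_half`).

References: Lee, *Introduction to Smooth Manifolds*, Thm. 4.5 (inverse function theorem), Prop. 3.9;
Dafermos–Rodnianski arXiv:0811.0354, §5.1 (ingoing Kerr–Schild chart). Elementary calculus otherwise.
-/

noncomputable section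

open scoped Manifold ContDiff Topology
open Set Filter Topology Literature.Geometry.Lorentzian
open Summit.FinalStateConjecture.FinalStateConjecture.Theorems.KerrShieldedDataExist.Negative
  (bentHeight mass_pos)
open Summit.FinalStateConjecture.FinalStateConjecture.Theorems.BentLabDeviation
  (contDiffAt_cutoff contDiff_radialHeight continuous_apply_zero)
open Summit.FinalStateConjecture.FinalStateConjecture.Theorems.SwallowTheDatum.KerrShieldedSettles.ExteriorDecomposition
  (map_nhds_timeShift injOn_timeShift)

namespace Summit.FinalStateConjecture.FinalStateConjecture.Cruxes.ModulatedKerrHandoff.SwallowTransfer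

section BentLab

variable {M a : ℝ}

/-! ## Smoothness of the shift `Θ` and of the chart `f` on the half-space `{x⁰ > 0}` -/

/-- The shift `Θ(x) = χ₁(|x̲|/x⁰ − 1) · T(|x̲|)` is `Cⁿ` at every point of the half-space `{x⁰ > 0}`
(product of the cutoff and the radial height). [folklore] -/
theorem contDiffAt_bentShift (h : |a| < M) {y : E4} (hy : 0 < y 0) {n : ℕ∞} :
    ContDiffAt ℝ n (fun z : E4 ↦ Real.smoothTransition (E4.spatialNorm z / z 0 - 1) *
      bentHeight M a (E4.spatialNorm z)) y :=
  (contDiffAt_cutoff hy).mul (contDiff_radialHeight h).contDiffAt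

/-- The bent lab chart `f(x) = x + Θ(x) e₀` is `Cⁿ` at every point of the half-space `{x⁰ > 0}`.
[folklore] -/
theorem contDiffAt_bentLab (h : |a| < M) {y : E4} (hy : 0 < y 0) {n : ℕ∞} :
    ContDiffAt ℝ n (fun x : E4 ↦ x + (Real.smoothTransition (E4.spatialNorm x / x 0 - 1) *
      bentHeight M a (E4.spatialNorm x)) • E4.basisVector 0) y :=
  contDiffAt_id.add ((contDiffAt_bentShift h hy).smul contDiffAt_const)

/-! ## The time derivative of the shift is the fibre derivative -/

/-- Along the time fibre through `y` the shift is the fibre shift `t ↦ χ₁(ρ/(y⁰ + t) − 1) · T(ρ)`,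
`ρ = |y̲|`. [folklore] -/
theorem bentShift_add_smul_basisVector_zero (y : E4) (t : ℝ) :
    Real.smoothTransition (E4.spatialNorm (y + t • E4.basisVector 0) /
        (y + t • E4.basisVector 0) 0 - 1) *
      bentHeight M a (E4.spatialNorm (y + t • E4.basisVector 0)) =
    Real.smoothTransition (E4.spatialNorm y / (y 0 + t) - 1) * bentHeight M a (E4.spatialNorm y) := by
  have hs : E4.spatialNorm (y + t • E4.basisVector 0) = E4.spatialNorm y := by
    simp only [E4.spatialNorm, Kerr.spatial_add_smul_basisVector_zero]
  have h0 : (y + t • E4.basisVector 0) 0 = y 0 + t := by simp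
  rw [hs, h0]

/-- **`∂₀Θ` is the fibre derivative**: `dΘ(y)(e₀) = χ₁′(ρ/s − 1) · (−ρ/s²) · T(ρ)` at `s = y⁰`, `ρ = |y̲|`
(`y⁰ > 0`; the line derivative of `Θ` along `e₀` is the derivative of the fibre shift,
`SwallowTransfer.hasDerivAt_fibreShift`). [folklore] -/
theorem fderiv_bentShift_basisVector_zero (h : |a| < M) {y : E4} (hy : 0 < y 0) :
    fderiv ℝ (fun z : E4 ↦ Real.smoothTransition (E4.spatialNorm z / z 0 - 1) *
        bentHeight M a (E4.spatialNorm z)) y (E4.basisVector 0) =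
      deriv Real.smoothTransition (E4.spatialNorm y / y 0 - 1) * (-E4.spatialNorm y / y 0 ^ 2) *
        bentHeight M a (E4.spatialNorm y) := by
  set Θ : E4 → ℝ := fun z : E4 ↦ Real.smoothTransition (E4.spatialNorm z / z 0 - 1) *
    bentHeight M a (E4.spatialNorm z) with hΘ
  have hd : DifferentiableAt ℝ Θ y :=
    (contDiffAt_bentShift h hy (n := 1)).differentiableAt one_ne_zero
  -- the line derivative of `Θ` along `e₀` ...
  have h1 : HasDerivAt (fun t : ℝ ↦ Θ (y + t • E4.basisVector 0))
      (fderiv ℝ Θ y (E4.basisVector 0)) 0 :=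
    hd.hasFDerivAt.hasLineDerivAt (E4.basisVector 0)
  -- ... is the derivative of the fibre shift at `s = y⁰`
  have h2 : HasDerivAt (fun s : ℝ ↦ Real.smoothTransition (E4.spatialNorm y / s - 1) *
        bentHeight M a (E4.spatialNorm y))
      (deriv Real.smoothTransition (E4.spatialNorm y / y 0 - 1) * (-E4.spatialNorm y / y 0 ^ 2) *
        bentHeight M a (E4.spatialNorm y)) (y 0 + 0) := by
    rw [add_zero]
    exact hasDerivAt_fibreShift M a (E4.spatialNorm y) hy.ne'
  have h3 := h2.comp_const_add (y 0) 0
  have heq : (fun t : ℝ ↦ Θ (y + t • E4.basisVector 0)) = fun t : ℝ ↦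
      Real.smoothTransition (E4.spatialNorm y / (y 0 + t) - 1) * bentHeight M a (E4.spatialNorm y) := by
    funext t
    exact bentShift_add_smul_basisVector_zero y t
  rw [heq] at h1
  exact h1.unique h3

/-- Beyond the late time `2048 M` the time derivative of the shift has absolute value `≤ 1/2`, so
`1 + ∂₀Θ ≠ 0` (the derivative `id + dΘ ⊗ e₀` of the chart is invertible). [folklore] -/
theorem one_add_fderiv_bentShift_ne_zero (h : |a| < M) {y : E4} (hy : 2048 * M ≤ y 0) :
    1 + fderiv ℝ (fun z : E4 ↦ Real.smoothTransition (E4.spatialNorm z / z 0 - 1) *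
        bentHeight M a (E4.spatialNorm z)) y (E4.basisVector 0) ≠ 0 := by
  have hM := mass_pos h
  have hy0 : 0 < y 0 := lt_of_lt_of_le (by positivity) hy
  rw [fderiv_bentShift_basisVector_zero h hy0]
  have h1 := abs_fibreDeriv_le_half h hy (E4.spatialNorm y)
  have h2 := neg_abs_le (deriv Real.smoothTransition (E4.spatialNorm y / y 0 - 1) *
    (-E4.spatialNorm y / y 0 ^ 2) * bentHeight M a (E4.spatialNorm y))
  intro h0
  linarith

/-- **Inverse function theorem for the bent lab chart**: beyond the late time `2048 M` the chart maps
neighbourhoods onto neighbourhoods (`ExteriorDecomposition.map_nhds_timeShift`). [folklore] -/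
theorem map_nhds_bentLab (h : |a| < M) {y : E4} (hy : 2048 * M ≤ y 0) :
    map (fun x : E4 ↦ x + (Real.smoothTransition (E4.spatialNorm x / x 0 - 1) *
      bentHeight M a (E4.spatialNorm x)) • E4.basisVector 0) (𝓝 y) =
    𝓝 (y + (Real.smoothTransition (E4.spatialNorm y / y 0 - 1) *
      bentHeight M a (E4.spatialNorm y)) • E4.basisVector 0) := by
  have hM := mass_pos h
  have hy0 : 0 < y 0 := lt_of_lt_of_le (by positivity) hy
  exact map_nhds_timeShift (contDiffAt_bentShift h hy0 (n := 1)) one_ne_zero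
    (one_add_fderiv_bentShift_ne_zero h hy)

/-! ## Injectivity and the open-embedding property on the pinned domain -/

/-- **The bent lab chart is injective on `{x⁰ > τ₀}`, `τ₀ ≥ 2048 M`**: it preserves the time fibres and is
strictly increasing along them (`SwallowTransfer.strictMonoOn_fibreMap`, `ExteriorDecomposition.injOn_timeShift`).
[folklore] -/
theorem injOn_bentLab (h : |a| < M) {τ₀ : ℝ} (hτ₀ : 2048 * M ≤ τ₀) :
    InjOn (fun x : E4 ↦ x + (Real.smoothTransition (E4.spatialNorm x / x 0 - 1) *
      bentHeight M a (E4.spatialNorm x)) • E4.basisVector 0) {x : E4 | τ₀ < x 0} := by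
  refine injOn_timeShift fun x hx y hy hsp hlt ↦ ?_
  have hx' : τ₀ < x 0 := hx
  have hy' : τ₀ < y 0 := hy
  have hρ : E4.spatialNorm x = E4.spatialNorm y := by
    simp only [E4.spatialNorm, hsp]
  dsimp only
  rw [hρ]
  exact strictMonoOn_fibreMap h (E4.spatialNorm y) (show 2048 * M ≤ x 0 by linarith)
    (show 2048 * M ≤ y 0 by linarith) hlt

/-- The pinned domain `{x⁰ > τ₀, r > rin}` is open (`Kerr.radius a` is continuous). [folklore] -/
theorem isOpen_pinnedDomain (a τ₀ rin : ℝ) : IsOpen {x : E4 | τ₀ < x 0 ∧ rin < Kerr.radius a x} :=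
  (isOpen_lt continuous_const continuous_apply_zero).inter
    (isOpen_lt continuous_const (Kerr.continuous_radius a))

/-- **The bent lab chart restricted to the pinned domain `{x⁰ > τ₀, r > rin}`, `τ₀ ≥ 2048 M`, is an open
embedding**: continuous, injective, and open (each point's neighbourhoods map onto neighbourhoods of the
image, and the domain is open in `E4`). [folklore] -/
theorem isOpenEmbedding_restrict_bentLab (h : |a| < M) {τ₀ : ℝ} (hτ₀ : 2048 * M ≤ τ₀) (rin : ℝ) :
    IsOpenEmbedding ({x : E4 | τ₀ < x 0 ∧ rin < Kerr.radius a x}.restrict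
      (fun x : E4 ↦ x + (Real.smoothTransition (E4.spatialNorm x / x 0 - 1) *
        bentHeight M a (E4.spatialNorm x)) • E4.basisVector 0)) := by
  set V : Set E4 := {x : E4 | τ₀ < x 0 ∧ rin < Kerr.radius a x} with hV
  set f : E4 → E4 := fun x : E4 ↦ x + (Real.smoothTransition (E4.spatialNorm x / x 0 - 1) *
    bentHeight M a (E4.spatialNorm x)) • E4.basisVector 0 with hf
  have hM := mass_pos h
  have hVo : IsOpen V := isOpen_pinnedDomain a τ₀ rin
  have hlate : ∀ x ∈ V, 2048 * M ≤ x 0 := fun x hx ↦ hτ₀.trans hx.1.le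
  have hpos : ∀ x ∈ V, 0 < x 0 := fun x hx ↦ lt_of_lt_of_le (by positivity) (hlate x hx)
  have hcont : Continuous (V.restrict f) :=
    continuousOn_iff_continuous_restrict.1 fun x hx ↦
      (contDiffAt_bentLab h (hpos x hx) (n := 0)).continuousAt.continuousWithinAt
  have hinj : Function.Injective (V.restrict f) :=
    injOn_iff_injective.1 ((injOn_bentLab h hτ₀).mono fun x hx ↦ hx.1)
  have hopen : IsOpenMap (V.restrict f) := by
    rw [isOpenMap_iff_nhds_le]
    rintro ⟨y, hy⟩
    have hval : map (Subtype.val : V → E4) (𝓝 (⟨y, hy⟩ : V)) = 𝓝 y :=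
      hVo.isOpenEmbedding_subtypeVal.map_nhds_eq ⟨y, hy⟩
    have key : map (V.restrict f) (𝓝 (⟨y, hy⟩ : V)) = 𝓝 (f y) := by
      rw [Set.restrict_eq, ← Filter.map_map, hval]
      exact map_nhds_bentLab h (hlate y hy)
    rw [key]
    exact le_rfl
  exact IsOpenEmbedding.of_continuous_injective_isOpenMap hcont hinj hopen

end BentLab

/-- **T2a `stub_bentLabSmooth`.** For sub-extremal `(M, a)` there is `τa > 0` (`τa = 2048 M`) such that for
every `τ₀ ≥ τa` the bent lab chart `f(x) = x + χ₁(|x̲|/x⁰ − 1) T(|x̲|) e₀` is `C^∞` on `{x⁰ > τ₀}`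
(`contDiffAt_bentLab`: the cutoff is smooth on `{x⁰ > 0}`, the radial height everywhere) and an open embedding
of the pinned domain `{x⁰ > τ₀, r > rin}` (`isOpenEmbedding_restrict_bentLab`: `f` preserves the time fibres and
is strictly increasing along them once `τ₀ ≥ 2048 M`, hence injective; `1 + ∂₀Θ ≥ 1/2 ≠ 0`, hence a local
homeomorphism by the inverse function theorem; an injective open continuous map on an open set is an open
embedding). The hypothesis `r₋ < rin` is not needed. [folklore] -/
theorem stub_bentLabSmooth : ∀ (M a rin : ℝ), |a| < M → Kerr.rMinus M a < rin →
    ∃ τa : ℝ, 0 < τa ∧ ∀ τ₀ : ℝ, τa ≤ τ₀ →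
      ContDiffOn ℝ ((⊤ : ℕ∞) : WithTop ℕ∞)
        (fun x : E4 ↦ x + (Real.smoothTransition (E4.spatialNorm x / x 0 - 1) *
            bentHeight M a (E4.spatialNorm x)) • E4.basisVector 0)
        {x : E4 | τ₀ < x 0} ∧
      Topology.IsOpenEmbedding ({x : E4 | τ₀ < x 0 ∧ rin < Kerr.radius a x}.restrict
        (fun x : E4 ↦ x + (Real.smoothTransition (E4.spatialNorm x / x 0 - 1) *
            bentHeight M a (E4.spatialNorm x)) • E4.basisVector 0)) := by
  intro M a rin h _
  have hM := mass_pos h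
  refine ⟨2048 * M, by positivity, fun τ₀ hτ₀ ↦ ⟨fun x hx ↦ ?_, isOpenEmbedding_restrict_bentLab h hτ₀ rin⟩⟩
  have hx' : τ₀ < x 0 := hx
  exact (contDiffAt_bentLab h (show 0 < x 0 by linarith) (n := ⊤)).contDiffWithinAt

end Summit.FinalStateConjecture.FinalStateConjecture.Cruxes.ModulatedKerrHandoff.SwallowTransfer

end
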